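import Summits.QuantumFields.YangMills.Theorems.VirialFluxGapRingDeficitDefs
import Summits.QuantumFields.YangMills.Theorems.FemtoTransferGapConstantModes
import Summits.QuantumFields.YangMills.Theorems.LuscherReductionRunningReductionTraceFormulaAveraging
import Summits.QuantumFields.YangMills.Theorems.ToronValleyVolumeLojasiewiczLocaliseQuaternion
import Summits.QuantumFields.YangMills.Theorems.ToronValleyVolumeLojasiewiczLocaliseRing
import Literature.MathematicalPhysics.QuantumFieldTheory.SU2HiggsKeyEstimate
import Literature.MathematicalPhysics.QuantumFieldTheory.Balaban1983to89.T4WilsonLinkAffine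
import HarnessLib

/-!
# The periodic ring deficit of a CONSTANT history is a commutator quartic — the `c`-only slice of the central chart of the toron valley
# (free-hands helper toward crux ⟨stmt-QuantumFields-24141⟩ `VirialFluxGap.PeriodicSoftness`; LEAD seat ym-line-sfw-p2 gen 92, `--supports 24141 --as helper`)

A CONSTANT ring history has every time slice equal to one spatially constant configuration `x ↦ u_i` (`u : Fin 3 → SU(2)`) and a constant seam
gauge field `x ↦ q`.  These histories form the 12-dimensional manifold `C` through each central flat history tangent to the 12 zero modes of
the Hessian of the zero-flux deficit `F₀ = RingDeficit.ringDeficit L 0` (3 constant spatial directions + the constant seam field, `su(2)`-valued).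
This file computes `F₀` on `C` EXACTLY:

* ★ `ringDeficit_const` — `F₀(const u q) = 2L⁴·Σ_{i<j} t(u_i u_j u_i⁻¹ u_j⁻¹) + L³·Σ_i t(u_i q u_i⁻¹ q⁻¹)`, `t(U) = 2 − Re tr U` the trace deficit
  (✓`su2Deficit`): the `2L − 1` interior bonds between equal slices cost nothing, every slice carries the constant-configuration Wilson action
  `L³ Σ_{i<j} t([u_i,u_j])` (✓`wilsonAction_const`), and the seam bond `U ↦ q U q⁻¹` costs `L³ Σ_i t([u_i, q])` (✓`timeCoupling_const`, gauge
  invariance of the Wilson action);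
* ★★ `ringDeficit_const_eq_commutator_quartic` — with `A_i = q(u_i)`, `B = q(q)` the unit quaternions (✓`su2Quat`):
  `F₀(const u q) = 2L⁴·Σ_{i<j} ‖A_iA_j − A_jA_i‖² + L³·Σ_i ‖A_iB − BA_i‖²`, because `t(UVU⁻¹V⁻¹) = ‖1 − ab a* b*‖² = ‖ab − ba‖²` for unit
  quaternions (`su2Deficit_commutator_eq`); by Lagrange's identity (✓`normSq_comm_eq`) each term is `4(|Im a|²|Im b|² − (Im a·Im b)²) = 4‖Im a × Im b‖²`
  (`ringDeficit_const_eq_imQuartic`): on `C` the deficit is a HOMOGENEOUS QUARTIC POLYNOMIAL of the imaginary parts (the hemisphere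
  coordinates), with NO higher-order corrections — so the weighted Euler field `¼·v·∂_v` of the «virial-field» plan for ⟨24141⟩ satisfies
  `X(F₀|_C) = F₀|_C` exactly on `C` (the identity ✓`ToronValleyVolume.ZeroMode.quartic_smul` ∕ ✓`zeroMode_virial` is this block's toy);
* ★ `ringDeficit_const_eq_zero_iff` — `F₀(const u q) = 0 ↔` the quadruple `(u₁,u₂,u₃,q)` is pairwise commuting: the valley meets `C` exactly in the
  commuting variety (the torons), the cone over which the two-sided state-density law of ⟨24497⟩ has its log and the one-sided virial bound has none.

THEOREMS ONLY (no `def`, no `sorry`, default heartbeats); constant histories are written as lambdas.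

HONEST LABEL: exact lattice algebra on a 12-dimensional family of histories; nothing of ⟨24141⟩ PeriodicSoftness, ⟨24497⟩, a rung, a leaf or a
summit is proved; the Yang–Mills mass gap is NOT proved by this; no summit is proved by a line.

References: M. Lüscher, Nucl. Phys. B 219 (1983) 233–261, §2 (torons: constant ∕ flat modes of the periodic box) [Luscher1983]; A. Coste,
A. González-Arroyo, J. Jurkiewicz, C.P. Korthals Altes, Nucl. Phys. B 262 (1985) 67–94 (the quartic zero-mode potential `Σ tr[c_μ,c_ν]²`)
[CosteEtAl1985]; I. Montvay, G. Münster, Quantum Fields on a Lattice (CUP 1994) (3.145) (transfer-matrix ring) [MontvayMunster1994].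
-/

set_option autoImplicit false

noncomputable section

open scoped Quaternion BigOperators
open Literature.MathematicalPhysics.QuantumFieldTheory hiding SU2
open Literature.MathematicalPhysics.QuantumLattice (su2Quat norm_su2Quat normSq_su2Quat quatMatrix_su2Quat quatMatrix_one fundamentalRep_apply)
open Summit.QuantumFields.YangMills.Theorems.FemtoTransferGap
open Summit.QuantumFields.YangMills.Theorems.VirialFluxGap.RingDeficit
open Summit.QuantumFields.YangMills.Theorems.ToronValleyVolume.Lojasiewicz (normSq_comm_eq imDot_self_nonneg ringDeficit_eq_sums timeCoupling_deficit_self)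
open Literature.MathematicalPhysics.QuantumFieldTheory.Balaban1983to89.T4WilsonLinkAffine (su2Quat_inv)

namespace Summit.QuantumFields.YangMills.Theorems.VirialFluxGap.ConstantHistory

/-! ## §1 Unit quaternions: the trace deficit of a group commutator is the squared norm of the algebra commutator -/

/-- For unit quaternions `a, b`: `‖1 − a b a* b*‖ = ‖ab − ba‖`. [folklore] -/
theorem norm_one_sub_comm_conj_eq {a b : ℍ} (ha : ‖a‖ = 1) (hb : ‖b‖ = 1) :
    ‖1 - a * b * star a * star b‖ = ‖a * b - b * a‖ := by
  have ha' : a * star a = 1 := by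
    rw [Quaternion.self_mul_star, Quaternion.normSq_eq_norm_mul_self, ha, mul_one, Quaternion.coe_one]
  have hb' : b * star b = 1 := by
    rw [Quaternion.self_mul_star, Quaternion.normSq_eq_norm_mul_self, hb, mul_one, Quaternion.coe_one]
  have key : 1 - a * b * star a * star b = (b * a - a * b) * (star a * star b) := by
    have e1 : b * a * (star a * star b) = 1 := by
      calc b * a * (star a * star b) = b * (a * star a) * star b := by simp only [mul_assoc]
        _ = 1 := by rw [ha', mul_one, hb']
    calc 1 - a * b * star a * star b = b * a * (star a * star b) - a * b * (star a * star b) := by rw [e1]; simp only [mul_assoc]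
      _ = (b * a - a * b) * (star a * star b) := by rw [sub_mul]
  rw [key, norm_mul, norm_mul, Quaternion.norm_star, Quaternion.norm_star, ha, hb, mul_one, mul_one, norm_sub_rev]

/-- ★ **The trace deficit of a group commutator in `SU(2)` is the squared norm of the quaternion commutator**:
`2 − Re tr(U V U⁻¹ V⁻¹) = ‖q(U)q(V) − q(V)q(U)‖²`. [folklore] -/
theorem su2Deficit_commutator_eq (U V : SU2) :
    su2Deficit (U * V * U⁻¹ * V⁻¹) = ‖su2Quat U * su2Quat V - su2Quat V * su2Quat U‖ ^ 2 := by
  rw [su2Deficit_eq_norm_sub_sq, su2Quat_mul, su2Quat_mul, su2Quat_mul, su2Quat_inv, su2Quat_inv,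
    norm_one_sub_comm_conj_eq (norm_su2Quat U) (norm_su2Quat V)]

/-- The trace deficit of a group commutator in Lagrange (imaginary-part) form:
`2 − Re tr(U V U⁻¹ V⁻¹) = 4(|Im a|²|Im b|² − (Im a·Im b)²)` (`a = q(U)`, `b = q(V)`) — a homogeneous QUARTIC in the imaginary parts. [folklore] -/
theorem su2Deficit_commutator_eq_imQuartic (U V : SU2) :
    su2Deficit (U * V * U⁻¹ * V⁻¹) =
      4 * (((su2Quat U).imI * (su2Quat U).imI + (su2Quat U).imJ * (su2Quat U).imJ + (su2Quat U).imK * (su2Quat U).imK) *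
            ((su2Quat V).imI * (su2Quat V).imI + (su2Quat V).imJ * (su2Quat V).imJ + (su2Quat V).imK * (su2Quat V).imK) -
          ((su2Quat U).imI * (su2Quat V).imI + (su2Quat U).imJ * (su2Quat V).imJ + (su2Quat U).imK * (su2Quat V).imK) ^ 2) := by
  rw [su2Deficit_commutator_eq, normSq_comm_eq]

/-- `2 − Re tr(U V U⁻¹ V⁻¹) = 0 ↔ U V = V U`. [folklore] -/
theorem su2Deficit_commutator_eq_zero_iff (U V : SU2) : su2Deficit (U * V * U⁻¹ * V⁻¹) = 0 ↔ U * V = V * U := by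
  rw [su2Deficit_commutator_eq, sq_eq_zero_iff, norm_eq_zero, sub_eq_zero]
  constructor
  · intro h
    apply Subtype.ext
    have h' : su2Quat (U * V) = su2Quat (V * U) := by rw [su2Quat_mul, su2Quat_mul, h]
    have := congrArg Literature.MathematicalPhysics.QuantumLattice.quatMatrix h'
    rwa [quatMatrix_su2Quat, quatMatrix_su2Quat] at this
  · intro h
    rw [← su2Quat_mul, ← su2Quat_mul, h]

/-- The trace deficit as the representation-level expression of the Wilson action: `(2:ℝ) − Re tr ρ(U) = t(U)` for `ρ = su2Rep`. [folklore] -/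
theorem two_sub_re_trace_su2Rep (U : SU2) : (2 : ℝ) - ((su2Rep U).trace).re = su2Deficit U := by
  rfl

/-! ## §2 The deficit of a constant history -/

variable {L : ℕ} [NeZero L]

/-- The time coupling of a constant configuration with itself is maximal: `T(const u, const u) = 6L³`. [folklore] -/
theorem timeCoupling_const_self (u : Fin 3 → SU2) :
    timeCoupling su2Rep (fun e : Edge 3 L => u e.2) (fun e : Edge 3 L => u e.2) = 6 * (L : ℝ) ^ 3 := by
  rw [timeCoupling_const]
  have h : ∀ i : Fin 3, ((su2Rep (u i * (u i)⁻¹)).trace).re = 2 := by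
    intro i
    rw [mul_inv_cancel, map_one, Matrix.trace_one]
    simp
  simp only [h, Finset.sum_const, Finset.card_univ, Fintype.card_fin, nsmul_eq_mul]
  push_cast; ring

omit [NeZero L] in
/-- A constant gauge transformation of a constant configuration is the conjugated constant configuration. [folklore] -/
theorem gaugeTransform_const_const (u : Fin 3 → SU2) (q : SU2) :
    gaugeTransform (fun _ : Site 3 L => q) (fun e : Edge 3 L => u e.2) = fun e : Edge 3 L => (fun i : Fin 3 => q * u i * q⁻¹) e.2 := by
  rfl

/-- The seam bond of a constant history: `6L³ − T(const u, q·(const u)·q⁻¹) = L³·Σ_i t(u_i q u_i⁻¹ q⁻¹)`. [folklore] -/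
theorem seamDeficit_const (u : Fin 3 → SU2) (q : SU2) :
    6 * (L : ℝ) ^ 3 - timeCoupling su2Rep (fun e : Edge 3 L => u e.2) (fun e : Edge 3 L => (fun i : Fin 3 => q * u i * q⁻¹) e.2) =
      (L : ℝ) ^ 3 * ∑ i : Fin 3, su2Deficit (u i * q * (u i)⁻¹ * q⁻¹) := by
  rw [timeCoupling_const su2Rep L u (fun i : Fin 3 => q * u i * q⁻¹)]
  have h : ∀ i : Fin 3, u i * (q * u i * q⁻¹)⁻¹ = u i * q * (u i)⁻¹ * q⁻¹ := by
    intro i; group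
  simp only [h]
  have e : ∀ i : Fin 3, ((su2Rep (u i * q * (u i)⁻¹ * q⁻¹)).trace).re = 2 - su2Deficit (u i * q * (u i)⁻¹ * q⁻¹) := by
    intro i; rw [← two_sub_re_trace_su2Rep]; ring
  simp only [e, Finset.sum_sub_distrib, Finset.sum_const, Finset.card_univ, Fintype.card_fin, nsmul_eq_mul]
  push_cast; ring

/-- The Wilson action of a constant configuration in deficit form: `S(const u) = L³·Σ_{i<j} t(u_i u_j u_i⁻¹ u_j⁻¹)`. [cite: Luscher1983, §2] -/
theorem wilsonAction_const_su2 (u : Fin 3 → SU2) :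
    wilsonAction su2Rep (fun e : Edge 3 L => u e.2) =
      (L : ℝ) ^ 3 * ∑ p : {p : Fin 3 × Fin 3 // p.1 < p.2}, su2Deficit (u p.1.1 * u p.1.2 * (u p.1.1)⁻¹ * (u p.1.2)⁻¹) := by
  rw [wilsonAction_const]
  rfl

/-- ★ The deficit of a history with ALL SLICES EQUAL to one configuration `U` and a constant seam field `q`:
`F₀ = 2L·S(U) + (6L³ − T(U, q·U·q⁻¹))` — the `2L − 1` interior bonds are free (✓`ringDeficit_eq_sums`, ✓`timeCoupling_deficit_self`,
gauge invariance of `S`). [cite: Luscher1983, §2] [cite: MontvayMunster1994, (3.145)] -/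
theorem ringDeficit_constSlices (U : GaugeConfig 3 L SU2) (q : SU2) :
    ringDeficit L (fun _ => false) (fun _ : Fin (2 * L - 1 + 1) => U, fun _ : Site 3 L => q) =
      2 * (L : ℝ) * wilsonAction su2Rep U + (6 * (L : ℝ) ^ 3 - timeCoupling su2Rep U (gaugeTransform (fun _ : Site 3 L => q) U)) := by
  have hL : 1 ≤ L := Nat.one_le_iff_ne_zero.mpr (NeZero.ne L)
  rw [ringDeficit_eq_sums]
  dsimp only
  rw [TT.twist3_false, wilsonAction_gaugeTransform]
  simp only [timeCoupling_deficit_self, Finset.sum_const_zero, zero_add, Finset.sum_const, Finset.card_univ, Fintype.card_fin,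
    nsmul_eq_mul]
  have hcast : ((2 * L - 1 : ℕ) : ℝ) = 2 * (L : ℝ) - 1 := by
    rw [Nat.cast_sub (by omega), Nat.cast_mul]; norm_num
  rw [hcast]; ring

/-- ★ **THE DEFICIT OF A CONSTANT HISTORY** (every slice `x ↦ u_i`, constant seam field `q`):
`F₀(const u q) = 2L·(L³·Σ_{i<j} t([u_i,u_j])) + L³·Σ_i t([u_i,q])` — interior bonds free, `2L` copies of the constant Wilson action, one seam bond.
[cite: Luscher1983, §2] [cite: MontvayMunster1994, (3.145)] -/
theorem ringDeficit_const (u : Fin 3 → SU2) (q : SU2) :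
    ringDeficit L (fun _ => false) (fun _ : Fin (2 * L - 1 + 1) => (fun e : Edge 3 L => u e.2), fun _ : Site 3 L => q) =
      2 * (L : ℝ) * ((L : ℝ) ^ 3 * ∑ p : {p : Fin 3 × Fin 3 // p.1 < p.2}, su2Deficit (u p.1.1 * u p.1.2 * (u p.1.1)⁻¹ * (u p.1.2)⁻¹)) +
        (L : ℝ) ^ 3 * ∑ i : Fin 3, su2Deficit (u i * q * (u i)⁻¹ * q⁻¹) := by
  rw [ringDeficit_constSlices, wilsonAction_const_su2, gaugeTransform_const_const, seamDeficit_const]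

/-- ★★ **THE DEFICIT OF A CONSTANT HISTORY IS A COMMUTATOR QUARTIC**: with the unit quaternions `A_i = q(u_i)`, `B = q(q)`,
`F₀(const u q) = 2L⁴·Σ_{i<j} ‖A_iA_j − A_jA_i‖² + L³·Σ_i ‖A_iB − BA_i‖²`. [cite: CosteEtAl1985] [cite: Luscher1983, §2] -/
theorem ringDeficit_const_eq_commutator_quartic (u : Fin 3 → SU2) (q : SU2) :
    ringDeficit L (fun _ => false) (fun _ : Fin (2 * L - 1 + 1) => (fun e : Edge 3 L => u e.2), fun _ : Site 3 L => q) =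
      2 * (L : ℝ) ^ 4 * ∑ p : {p : Fin 3 × Fin 3 // p.1 < p.2}, ‖su2Quat (u p.1.1) * su2Quat (u p.1.2) - su2Quat (u p.1.2) * su2Quat (u p.1.1)‖ ^ 2 +
        (L : ℝ) ^ 3 * ∑ i : Fin 3, ‖su2Quat (u i) * su2Quat q - su2Quat q * su2Quat (u i)‖ ^ 2 := by
  rw [ringDeficit_const]
  simp only [su2Deficit_commutator_eq]
  ring

/-- The same in Lagrange (imaginary-part) form: every term is `4(|Im a|²|Im b|² − (Im a·Im b)²) = 4‖Im a × Im b‖²` — a HOMOGENEOUS QUARTIC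
polynomial in the imaginary parts of `(A₁, A₂, A₃, B)`, with no higher-order correction. [cite: CosteEtAl1985] -/
theorem ringDeficit_const_eq_imQuartic (u : Fin 3 → SU2) (q : SU2) :
    ringDeficit L (fun _ => false) (fun _ : Fin (2 * L - 1 + 1) => (fun e : Edge 3 L => u e.2), fun _ : Site 3 L => q) =
      2 * (L : ℝ) ^ 4 * ∑ p : {p : Fin 3 × Fin 3 // p.1 < p.2},
          4 * (((su2Quat (u p.1.1)).imI * (su2Quat (u p.1.1)).imI + (su2Quat (u p.1.1)).imJ * (su2Quat (u p.1.1)).imJ +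
                  (su2Quat (u p.1.1)).imK * (su2Quat (u p.1.1)).imK) *
                ((su2Quat (u p.1.2)).imI * (su2Quat (u p.1.2)).imI + (su2Quat (u p.1.2)).imJ * (su2Quat (u p.1.2)).imJ +
                  (su2Quat (u p.1.2)).imK * (su2Quat (u p.1.2)).imK) -
              ((su2Quat (u p.1.1)).imI * (su2Quat (u p.1.2)).imI + (su2Quat (u p.1.1)).imJ * (su2Quat (u p.1.2)).imJ +
                  (su2Quat (u p.1.1)).imK * (su2Quat (u p.1.2)).imK) ^ 2) +
        (L : ℝ) ^ 3 * ∑ i : Fin 3,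
          4 * (((su2Quat (u i)).imI * (su2Quat (u i)).imI + (su2Quat (u i)).imJ * (su2Quat (u i)).imJ + (su2Quat (u i)).imK * (su2Quat (u i)).imK) *
                ((su2Quat q).imI * (su2Quat q).imI + (su2Quat q).imJ * (su2Quat q).imJ + (su2Quat q).imK * (su2Quat q).imK) -
              ((su2Quat (u i)).imI * (su2Quat q).imI + (su2Quat (u i)).imJ * (su2Quat q).imJ + (su2Quat (u i)).imK * (su2Quat q).imK) ^ 2) := by
  rw [ringDeficit_const_eq_commutator_quartic]
  simp only [normSq_comm_eq]

/-- ★ **The valley meets the constant histories in the commuting variety**: `F₀(const u q) = 0 ↔` every pair among `u₁, u₂, u₃, q` commutes.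
[cite: Luscher1983, §2] -/
theorem ringDeficit_const_eq_zero_iff (u : Fin 3 → SU2) (q : SU2) :
    ringDeficit L (fun _ => false) (fun _ : Fin (2 * L - 1 + 1) => (fun e : Edge 3 L => u e.2), fun _ : Site 3 L => q) = 0 ↔
      (∀ i j : Fin 3, u i * u j = u j * u i) ∧ (∀ i : Fin 3, u i * q = q * u i) := by
  have hL0 : (0 : ℝ) < L := Nat.cast_pos.mpr (Nat.pos_of_ne_zero (NeZero.ne L))
  have hL3 : (0 : ℝ) < (L : ℝ) ^ 3 := pow_pos hL0 3
  rw [ringDeficit_const]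
  -- abbreviate the two sums
  generalize hs1 : (∑ p : {p : Fin 3 × Fin 3 // p.1 < p.2}, su2Deficit (u p.1.1 * u p.1.2 * (u p.1.1)⁻¹ * (u p.1.2)⁻¹)) = s1
  generalize hs2 : (∑ i : Fin 3, su2Deficit (u i * q * (u i)⁻¹ * q⁻¹)) = s2
  have hnn1 : ∀ p : {p : Fin 3 × Fin 3 // p.1 < p.2}, 0 ≤ su2Deficit (u p.1.1 * u p.1.2 * (u p.1.1)⁻¹ * (u p.1.2)⁻¹) :=
    fun p => by rw [su2Deficit_commutator_eq]; exact sq_nonneg _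
  have hnn2 : ∀ i : Fin 3, 0 ≤ su2Deficit (u i * q * (u i)⁻¹ * q⁻¹) := fun i => by
    rw [su2Deficit_commutator_eq]; exact sq_nonneg _
  have hs1n : 0 ≤ s1 := by rw [← hs1]; exact Finset.sum_nonneg fun p _ => hnn1 p
  have hs2n : 0 ≤ s2 := by rw [← hs2]; exact Finset.sum_nonneg fun i _ => hnn2 i
  -- the scalar equivalence `2L·(L³·s1) + L³·s2 = 0 ↔ s1 = 0 ∧ s2 = 0`
  have hscal : 2 * (L : ℝ) * ((L : ℝ) ^ 3 * s1) + (L : ℝ) ^ 3 * s2 = 0 ↔ s1 = 0 ∧ s2 = 0 := by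
    constructor
    · intro h
      have hA : 0 ≤ 2 * (L : ℝ) * ((L : ℝ) ^ 3 * s1) := mul_nonneg (mul_nonneg (by norm_num) hL0.le) (mul_nonneg hL3.le hs1n)
      have hB : 0 ≤ (L : ℝ) ^ 3 * s2 := mul_nonneg hL3.le hs2n
      obtain ⟨hA0, hB0⟩ := (add_eq_zero_iff_of_nonneg hA hB).mp h
      have h2L : 2 * (L : ℝ) * (L : ℝ) ^ 3 ≠ 0 := mul_ne_zero (mul_ne_zero two_ne_zero hL0.ne') hL3.ne'
      refine ⟨?_, ?_⟩
      · rw [← mul_assoc] at hA0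
        rcases mul_eq_zero.mp hA0 with h' | h'
        · exact absurd h' h2L
        · exact h'
      · rcases mul_eq_zero.mp hB0 with h' | h'
        · exact absurd h' hL3.ne'
        · exact h'
    · rintro ⟨h1, h2⟩
      rw [h1, h2]; ring
  rw [hscal, ← hs1, ← hs2, Finset.sum_eq_zero_iff_of_nonneg (fun p _ => hnn1 p), Finset.sum_eq_zero_iff_of_nonneg (fun i _ => hnn2 i)]
  constructor
  · rintro ⟨hz1, hz2⟩
    refine ⟨fun i j => ?_, fun i => (su2Deficit_commutator_eq_zero_iff _ _).mp (hz2 i (Finset.mem_univ _))⟩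
    rcases lt_trichotomy i j with hij | hij | hij
    · exact (su2Deficit_commutator_eq_zero_iff (u i) (u j)).mp (hz1 ⟨(i, j), hij⟩ (Finset.mem_univ _))
    · subst hij; rfl
    · exact ((su2Deficit_commutator_eq_zero_iff (u j) (u i)).mp (hz1 ⟨(j, i), hij⟩ (Finset.mem_univ _))).symm
  · rintro ⟨h1, h2⟩
    exact ⟨fun p _ => (su2Deficit_commutator_eq_zero_iff _ _).mpr (h1 _ _), fun i _ => (su2Deficit_commutator_eq_zero_iff _ _).mpr (h2 i)⟩

end Summit.QuantumFields.YangMills.Theorems.VirialFluxGap.ConstantHistory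

end
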